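import Summits.QuantumFields.YangMills.Theorems.BalabanUVNodesN11TkNoExpansionSumTransportIntegrable

/-!
# DAG node N11 — THE JOINT-MEASURABILITY BINDERS OF THE `_of_integrable` CHAIN ARE IMPLIED BY ITS INTEGRABILITY BINDERS: the joint law of `(Ū, U)` is carried by
# the AVERAGING GRAPH, on which every integrand family is its graph composite (door (d2) of this seat's g10 census; kernel bookkeeping)

HEADER — WORK-UNIT METADATA.  Cell `pub-ymgap`, YM-PLAN Track A (HUMAN RULING D-0062), seat `pub-ymgap-dag-n11-d` (g10; R134 fan-out seat N11 [B14], strategy s2),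
route `BalabanUVNodes` rev 25, item K1⁷ `StabilityBAtRecordR13SepCoPH` = stmt-QuantumFields-20542 (helper, `--kind proof --supports 20542 --as helper`, count-neutral).
[III] = [Balaban1988Convergent].  Over `T4AveragingDisintegration` (`jointLaw`, `jointLaw_graph_compl`, `aestronglyMeasurable_comp_snd_jointLaw`, `integral_graph_eq`,
`kernelTransport`), 11a `Node00.TkOfRecord` (`kernelRTOfRecord`, `genDataOfRecord`, `tkBranchOfRecord`), def-T `Node00.TStepOfRecord` (`transportOfRecord`) and this
seat's g9 files R1 `…N11TkFullBondTransportIntegrable` (p556937), R2 `…N11TkNoExpansionSumTransportIntegrable` (p558069).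

WHY THIS FILE.  The g9 re-typing `hC ↦ hI` of the no-expansion 𝐓-step chain left, beside graph-integrability `hI`, a JOINT-MEASURABILITY binder on every integrand family
(`hf ∕ hm : Measurable (Function.uncurry f)`; downstream `hmB` «old branch measurable», `hΦm` «old operand measurable» — the second of the three binders of the
off-diagonal residue p569094, referee READ-733).  It is REDUNDANT: the only measure against which joint measurability was ever used is the joint law `(Ū, U)_* dU`
(and its restricted twin), and that law is CARRIED BY THE GRAPH `{V′ = Ū}` (`jointLaw_graph_compl`; the diagonal of the coarse field space is measurable —
`MeasurableEq` from `StandardBorelSpace`); on the graph the family `(V′, U) ↦ f V′ U` IS its graph composite `U ↦ f Ū U`, whose a.e.-strong measurability is part of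
`hI`.  This file re-derives R1 and R2 with the measurability binders DROPPED (proofs verbatim otherwise); the sequels re-derive R3 → R4a → R4b → D the same way.

WHAT THIS FILE PROVES (0 `sorry`, 0 `def`; generic in `N`, the fluctuation space `V`, the weights `W`).
§0 `aestronglyMeasurable_jointLaw_of_graph` (generic: `AEStronglyMeasurable (g ∘ graph) ν → AEStronglyMeasurable g (jointLaw ν avg)` under `MeasurableEq`).
§1 ★ `kernelRTOfRecord_full_ae_eq_transportOfRecord_of_graph` — R1's full-bond face with `hf` dropped (hypothesis: graph-integrability `hI` alone).
§2 `ae_integrable_section_of_graph`, `transportOfRecord_finset_sum_ae_of_graph`, ★ `TkOfRecord_succ_ae_eq_sum_transportOfRecord_of_Omega_empty_of_graph` — R2's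
   three theorems with `hm` dropped.

HONEST FRAMING.  Helper lane of K1⁷; kernel bookkeeping (measure theory of the tree's own transports); nothing of Bałaban's is asserted; no accepted theorem is
edited (the `_of_graph` editions stand beside the `_of_integrable` ones).  N11 NOT discharged; K1⁷ NOT closed; counts unmoved (typed 28∕28 · discharged 5∕27).  One
finite four-torus programme at fixed `ε = L^{−K}` — NOT ℝ⁴, NOT OS, NOT a mass gap, NOT Clay.  No `sorry`, `axiom`, `instance`, `notation`.
Sources (SHAPE only): [III] (2.21)–(2.22) p.258, (3.1) p.264, (3.24)–(3.25) p.270; [Balaban1985Averaging] (10) p.19.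
-/

noncomputable section

open MeasureTheory
open scoped BigOperators Matrix.Norms.L2Operator NNReal ENNReal

namespace Summit.QuantumFields.YangMills.Theorems.BalabanUVNodesN11TkFullBondTransportGraph

open Literature.MathematicalPhysics.QuantumFieldTheory.Balaban1983to89 T4Continuum T4FiniteEpsInhabited Node00 Node00.Tk
open T4AveragingDisintegration (kernelTransport margDensity condLaw jointLaw measurable_margDensity integrable_margDensity_mul integral_graph_eq
  integrable_jointLaw_iff ae_eq_of_forall_integral_mul_eq jointLaw_graph_compl aestronglyMeasurable_comp_snd_jointLaw withDensity_margDensity avgKernel)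
open BalabanUVNodesN11TkNoExpansionSumTransportIntegrable (transportOfRecord_eq_zero_of_margDensity_eq_zero)

/-! ## §0  The joint law of `(avg U, U)` is carried by the graph: graph-a.e.-measurability suffices -/

section Graph

variable {α β : Type*} [MeasurableSpace α] [MeasurableSpace β] [MeasurableEq α]

/-- **A FAMILY WHOSE GRAPH COMPOSITE `U ↦ g(avg U, U)` IS `ν`-A.E.-STRONGLY MEASURABLE IS A.E.-STRONGLY MEASURABLE ON THE JOINT LAW OF `(avg U, U)`** — the joint law is
carried by the graph `{z | z.1 = avg z.2}` (`jointLaw_graph_compl`), on which `g z = g (avg z.2, z.2)`. [cite: Balaban1985Averaging, (10) p.19 (bookkeeping)] -/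
theorem aestronglyMeasurable_jointLaw_of_graph (ν : Measure β) {avg : β → α} (havg : Measurable avg) {g : α × β → ℝ}
    (hg : AEStronglyMeasurable (fun U => g (avg U, U)) ν) : AEStronglyMeasurable g (jointLaw ν avg) := by
  have h1 : AEStronglyMeasurable (fun z : α × β => g (avg z.2, z.2)) (jointLaw ν avg) :=
    aestronglyMeasurable_comp_snd_jointLaw ν havg hg
  refine h1.congr ?_
  filter_upwards [measure_eq_zero_iff_ae_notMem.1 (jointLaw_graph_compl ν havg)] with z hz
  have hz' : z.1 = avg z.2 := by
    by_contra hne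
    exact hz (Set.mem_compl hne)
  rw [← hz']

end Graph

variable (F : T4Family) (N : ℕ) [NeZero N]

/-! ## §1  R1's full-bond face, joint measurability dropped -/

/-- **★ THE FULL-BOND-SET FACE OF 11a's V-FACTOR UNDER GRAPH-INTEGRABILITY ALONE** (p556937's `kernelRTOfRecord_full_ae_eq_transportOfRecord_of_integrable` with the
binder `hf : Measurable (Function.uncurry f)` DROPPED): for `j < K`, bond finsets containing every bond, and ANY integrand family `f V y` whose graph restriction
`U ↦ f(Ū, U|sV)` is `dU`-integrable, 11a's restricted kernel transport of `f V` read at `V|sV′` equals def-T's transport of the `V`-slice, `dV`-a.e.  The two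
joint-law measurabilities the a.e.-uniqueness argument needs come from the graph (§0). [cite: Balaban1988Convergent, (2.21)–(2.22) p.258, (3.1) p.264; Balaban1985Averaging, (10) p.19] -/
theorem kernelRTOfRecord_full_ae_eq_transportOfRecord_of_graph (K j : ℕ) (hj : j < K) {hdec : DecidableEq (PBond (F.P K) j)}
    (sV : Finset (PBond (F.P K) j)) (hV : ∀ b, b ∈ sV) (sV' : Finset (PBond (F.P K) (j + 1))) (hV' : ∀ b, b ∈ sV')
    (f : GaugeField (F.P K) (j + 1) (SU N) → (↥sV → SU N) → ℝ)
    (hI : Integrable (fun U : GaugeField (F.P K) j (SU N) => f ((avOfRecord F N K j).avg U) (fun b => U b)) (fieldMeasure (F.P K) j (SU N))) :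
    (fun V => kernelRTOfRecord F N K j sV sV' (f V) (fun b => V b)) =ᵐ[fieldMeasure (F.P K) (j + 1) (SU N)]
      fun V => transportOfRecord F N K j (fun U => f V (fun b => U b)) V := by
  -- the reindexing equivalences
  let e : ↥sV ≃ PBond (F.P K) j := Equiv.subtypeUnivEquiv hV
  let e' : ↥sV' ≃ PBond (F.P K) (j + 1) := Equiv.subtypeUnivEquiv hV'
  let E : (↥sV → SU N) ≃ᵐ GaugeField (F.P K) j (SU N) := MeasurableEquiv.piCongrLeft (fun _ : PBond (F.P K) j => SU N) e
  let E' : (↥sV' → SU N) ≃ᵐ GaugeField (F.P K) (j + 1) (SU N) :=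
    MeasurableEquiv.piCongrLeft (fun _ : PBond (F.P K) (j + 1) => SU N) e'
  have hEs : ∀ (U : GaugeField (F.P K) j (SU N)), E.symm U = fun b : ↥sV => U b.1 := fun U => rfl
  have hEs' : ∀ (V : GaugeField (F.P K) (j + 1) (SU N)), E'.symm V = fun b : ↥sV' => V b.1 := fun V => rfl
  have hE : ∀ (y : ↥sV → SU N) (b : PBond (F.P K) j), E y b = y ⟨b, hV b⟩ := fun y b => by
    change E y (e ⟨b, hV b⟩) = y ⟨b, hV b⟩
    exact MeasurableEquiv.piCongrLeft_apply_apply e (β := fun _ : PBond (F.P K) j => SU N) y ⟨b, hV b⟩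
  -- measure preservation
  have mpE : MeasurePreserving E (Measure.pi fun _ : ↥sV => (HaarData.haar : Measure (SU N))) (fieldMeasure (F.P K) j (SU N)) := by
    unfold fieldMeasure
    exact measurePreserving_piCongrLeft (fun _ : PBond (F.P K) j => (HaarData.haar : Measure (SU N))) e
  have mpE' : MeasurePreserving E' (Measure.pi fun _ : ↥sV' => (HaarData.haar : Measure (SU N)))
      (fieldMeasure (F.P K) (j + 1) (SU N)) := by
    unfold fieldMeasure
    exact measurePreserving_piCongrLeft (fun _ : PBond (F.P K) (j + 1) => (HaarData.haar : Measure (SU N))) e'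
  have mpEs : MeasurePreserving E.symm (fieldMeasure (F.P K) j (SU N)) (Measure.pi fun _ : ↥sV => (HaarData.haar : Measure (SU N))) :=
    MeasurePreserving.symm E mpE
  have mpE's : MeasurePreserving E'.symm (fieldMeasure (F.P K) (j + 1) (SU N))
      (Measure.pi fun _ : ↥sV' => (HaarData.haar : Measure (SU N))) :=
    MeasurePreserving.symm E' mpE'
  -- notation
  set μ := fieldMeasure (F.P K) j (SU N) with hμ
  set μ' := fieldMeasure (F.P K) (j + 1) (SU N) with hμ'
  set ν : Measure (↥sV → SU N) := Measure.pi fun _ : ↥sV => (HaarData.haar : Measure (SU N)) with hν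
  set ν' : Measure (↥sV' → SU N) := Measure.pi fun _ : ↥sV' => (HaarData.haar : Measure (SU N)) with hν'
  haveI : IsProbabilityMeasure μ := Missing.isProbabilityMeasure_fieldMeasure (F.P K) j
  haveI : IsProbabilityMeasure μ' := Missing.isProbabilityMeasure_fieldMeasure (F.P K) (j + 1)
  set av := (avOfRecord F N K j).avg with hav
  have hmav : Measurable av := avOfRecord_measurable F N K j
  have hac : μ.map av ≪ μ' := avOfRecord_haarAC F N K j hj
  -- the restricted averaging on the full bond sets IS `av` read through the equivalences
  set avg' := avgRestrOfRecord F N K j sV sV' with havg'def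
  have havg' : avg' = fun y => E'.symm (av (E y)) := by
    funext y b'
    have hupd : Function.updateFinset (fun _ : PBond (F.P K) j => (1 : SU N)) sV y = E y := by
      funext b
      rw [Function.updateFinset_def]
      simp only [dif_pos (hV b), hE]
    show (avOfRecord F N K j).avg (Function.updateFinset (fun _ => 1) sV y) b' = _
    rw [hupd, hEs']
  have hmavg' : Measurable avg' := by
    rw [havg']; exact E'.symm.measurable.comp (hmav.comp E.measurable)
  have hac' : ν.map avg' ≪ ν' := by
    rw [havg']
    have h1 : ν.map (fun y => E'.symm (av (E y))) = ((ν.map E).map av).map E'.symm := by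
      rw [Measure.map_map hmav E.measurable, Measure.map_map E'.symm.measurable (hmav.comp E.measurable)]
      rfl
    rw [h1, mpE.map_eq, ← mpE's.map_eq]
    exact hac.map E'.symm.measurable
  -- graph-integrability in the two presentations
  have hIB : Integrable (fun U => f (av U) (E.symm U)) μ := hI
  have hIA : Integrable (fun y => f (E' (avg' y)) y) ν := by
    refine (mpEs.integrable_comp_emb E.symm.measurableEmbedding).1 (hIB.congr (ae_of_all _ fun U => ?_))
    have hU : E' (avg' (E.symm U)) = av U := by
      rw [havg']
      simp only [E.apply_symm_apply, E'.apply_symm_apply]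
    simp only [Function.comp_def, hU]
  -- a.e.-strong measurability of the two slice integrands ON THE JOINT LAWS: the joint laws are carried by the averaging graphs, on which the integrands are
  -- the graph composites, a.e.-strongly measurable as parts of `hIB`, `hIA` (no joint measurability of `f` is needed)
  have hmB : AEStronglyMeasurable (fun z : GaugeField (F.P K) (j + 1) (SU N) × GaugeField (F.P K) j (SU N) => f z.1 (E.symm z.2)) (jointLaw μ av) :=
    aestronglyMeasurable_jointLaw_of_graph μ hmav hIB.1
  have hmA : AEStronglyMeasurable (fun z : (↥sV' → SU N) × (↥sV → SU N) => f (E' z.1) z.2) (jointLaw ν avg') :=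
    aestronglyMeasurable_jointLaw_of_graph ν hmavg' hIA.1
  have hgiB : Integrable (fun z : GaugeField (F.P K) (j + 1) (SU N) × GaugeField (F.P K) j (SU N) => f z.1 (E.symm z.2)) (jointLaw μ av) :=
    (integrable_jointLaw_iff μ hmav hmB).2 hIB
  have hgiA : Integrable (fun z : (↥sV' → SU N) × (↥sV → SU N) => f (E' z.1) z.2) (jointLaw ν avg') :=
    (integrable_jointLaw_iff ν hmavg' hmA).2 hIA
  -- integrability of the two transports
  have hintB : Integrable (fun V => kernelTransport μ μ' av (fun U => f V (E.symm U)) V) μ' := by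
    have hI' := (integrable_margDensity_mul μ μ' hmav hac hgiB).integral_compProd
    refine hI'.congr (ae_of_all _ fun V => ?_)
    simp only [kernelTransport]
    exact integral_const_mul _ _
  have hintA0 : Integrable (fun y' => kernelTransport ν ν' avg' (f (E' y')) y') ν' := by
    have hI' := (integrable_margDensity_mul ν ν' hmavg' hac' hgiA).integral_compProd
    refine hI'.congr (ae_of_all _ fun y' => ?_)
    simp only [kernelTransport]
    exact integral_const_mul _ _
  have hintA : Integrable (fun V => kernelTransport ν ν' avg' (f V) (E'.symm V)) μ' := by
    have h := (mpE's.integrable_comp_emb E'.symm.measurableEmbedding).2 hintA0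
    refine h.congr (ae_of_all _ fun V => ?_)
    simp only [Function.comp_def, E'.apply_symm_apply]
  -- the goal in E-form
  show (fun V => kernelTransport ν ν' avg' (f V) (E'.symm V)) =ᵐ[μ'] fun V => kernelTransport μ μ' av (fun U => f V (E.symm U)) V
  refine ae_eq_of_forall_integral_mul_eq hintA hintB fun φ hφm ⟨Cφ, hφ⟩ => ?_
  have hφb : ∀ V, ‖φ V‖ ≤ Cφ := fun V => by rw [Real.norm_eq_abs]; exact hφ V
  -- B side: disintegration along `av`
  have hB : ∫ V, kernelTransport μ μ' av (fun U => f V (E.symm U)) V * φ V ∂μ' = ∫ U, f (av U) (E.symm U) * φ (av U) ∂μ := by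
    have hgm : AEStronglyMeasurable (fun z : GaugeField (F.P K) (j + 1) (SU N) × GaugeField (F.P K) j (SU N) => f z.1 (E.symm z.2) * φ z.1)
        (jointLaw μ av) := hmB.mul (hφm.comp measurable_fst).aestronglyMeasurable
    have hg : Integrable (fun U => f (av U) (E.symm U) * φ (av U)) μ :=
      hIB.mul_bdd (hφm.comp hmav).aestronglyMeasurable (Filter.Eventually.of_forall fun U => hφb _)
    have key := integral_graph_eq μ μ' hmav hac
      (g := fun z : GaugeField (F.P K) (j + 1) (SU N) × GaugeField (F.P K) j (SU N) => f z.1 (E.symm z.2) * φ z.1) hgm hg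
    rw [key]
    refine integral_congr_ae (ae_of_all _ fun V => ?_)
    simp only [kernelTransport]
    rw [integral_mul_const]
    ring
  -- A side: change variables `V = E′ y′`, disintegrate along `avg′`, change variables `y = E⁻¹ U`
  have hA : ∫ V, kernelTransport ν ν' avg' (f V) (E'.symm V) * φ V ∂μ' = ∫ U, f (av U) (E.symm U) * φ (av U) ∂μ := by
    have h1 : ∫ V, kernelTransport ν ν' avg' (f V) (E'.symm V) * φ V ∂μ' =
        ∫ y', kernelTransport ν ν' avg' (f (E' y')) y' * φ (E' y') ∂ν' := by
      rw [← mpE'.integral_comp E'.measurableEmbedding]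
      simp only [E'.symm_apply_apply]
    have hgm' : AEStronglyMeasurable (fun z : (↥sV' → SU N) × (↥sV → SU N) => f (E' z.1) z.2 * φ (E' z.1)) (jointLaw ν avg') :=
      hmA.mul (hφm.comp (E'.measurable.comp measurable_fst)).aestronglyMeasurable
    have hg' : Integrable (fun y => f (E' (avg' y)) y * φ (E' (avg' y))) ν :=
      hIA.mul_bdd (hφm.comp (E'.measurable.comp hmavg')).aestronglyMeasurable (Filter.Eventually.of_forall fun y => hφb _)
    have key' := integral_graph_eq ν ν' hmavg' hac'
      (g := fun z : (↥sV' → SU N) × (↥sV → SU N) => f (E' z.1) z.2 * φ (E' z.1)) hgm' hg'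
    have h2 : ∫ y', kernelTransport ν ν' avg' (f (E' y')) y' * φ (E' y') ∂ν' = ∫ y, f (E' (avg' y)) y * φ (E' (avg' y)) ∂ν := by
      rw [key']
      refine integral_congr_ae (ae_of_all _ fun y' => ?_)
      simp only [kernelTransport]
      rw [integral_mul_const]
      ring
    have h3 : ∫ y, f (E' (avg' y)) y * φ (E' (avg' y)) ∂ν = ∫ U, f (av U) (E.symm U) * φ (av U) ∂μ := by
      rw [← mpEs.integral_comp E.symm.measurableEmbedding]
      refine integral_congr_ae (ae_of_all _ fun U => ?_)
      have hU : E' (avg' (E.symm U)) = av U := by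
        rw [havg']
        simp only [E.apply_symm_apply, E'.apply_symm_apply]
      simp only [hU]
    rw [h1, h2, h3]
  rw [hA, hB]

/-! ## §2  R2's a.e. section-integrability, additivity, and the level-(k+1) no-expansion slot as a sum of transports — joint measurability dropped -/

/-- **GRAPH-INTEGRABLE ⇒ KERNEL-INTEGRABLE SECTIONS for `dV′`-a.e. `V′` with positive marginal density** (p558069 §1 with `hm` dropped).
[cite: Balaban1985Averaging, (10) p.19 (bookkeeping)] -/
theorem ae_integrable_section_of_graph (K k : ℕ) (hk : k < K)
    {f : GaugeField (F.P K) (k + 1) (SU N) → GaugeField (F.P K) k (SU N) → ℝ}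
    (hI : Integrable (fun U => f ((avOfRecord F N K k).avg U) U) (fieldMeasure (F.P K) k (SU N))) :
    ∀ᵐ V' ∂fieldMeasure (F.P K) (k + 1) (SU N),
      margDensity (fieldMeasure (F.P K) k (SU N)) (fieldMeasure (F.P K) (k + 1) (SU N)) (avOfRecord F N K k).avg V' ≠ 0 →
        Integrable (f V') (avgKernel (avOfRecord F N K k).avg V') := by
  set μ := fieldMeasure (F.P K) k (SU N)
  set μ' := fieldMeasure (F.P K) (k + 1) (SU N)
  set av := (avOfRecord F N K k).avg
  have hmav : Measurable av := avOfRecord_measurable F N K k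
  have hac : μ.map av ≪ μ' := avOfRecord_haarAC F N K k hk
  have hgi : Integrable (Function.uncurry f) (jointLaw μ av) :=
    (integrable_jointLaw_iff μ hmav (aestronglyMeasurable_jointLaw_of_graph μ hmav hI.1)).2 hI
  have h1 : ∀ᵐ V' ∂(jointLaw μ av).fst, Integrable (fun U => Function.uncurry f (V', U)) ((jointLaw μ av).condKernel V') := hgi.condKernel_ae
  have hfst : (jointLaw μ av).fst = μ'.withDensity (fun V => (margDensity μ μ' av V : ℝ≥0∞)) := by
    rw [T4AveragingDisintegration.jointLaw_fst μ hmav, withDensity_margDensity μ μ' hmav hac]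
  rw [hfst, ae_withDensity_iff measurable_margDensity.coe_nnreal_ennreal] at h1
  filter_upwards [h1] with V' hV' hne
  exact hV' (by exact_mod_cast hne)

/-- **def-T's TRANSPORT IS ADDITIVE OVER FINITE SUMS, A.E., FOR GRAPH-INTEGRABLE FAMILIES** (p558069's `transportOfRecord_finset_sum_ae` with `hm` dropped).
[cite: Balaban1988Convergent, (3.1) p.264 (bookkeeping)] -/
theorem transportOfRecord_finset_sum_ae_of_graph (K k : ℕ) (hk : k < K) {ι : Type*} (S : Finset ι)
    (f : ι → GaugeField (F.P K) (k + 1) (SU N) → GaugeField (F.P K) k (SU N) → ℝ)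
    (hI : ∀ i ∈ S, Integrable (fun U => f i ((avOfRecord F N K k).avg U) U) (fieldMeasure (F.P K) k (SU N))) :
    ∀ᵐ V' ∂fieldMeasure (F.P K) (k + 1) (SU N),
      transportOfRecord F N K k (fun U => ∑ i ∈ S, f i V' U) V' = ∑ i ∈ S, transportOfRecord F N K k (f i V') V' := by
  have hall := (Filter.eventually_all_finset S).2 fun i hi => ae_integrable_section_of_graph F N K k hk (hI i hi)
  filter_upwards [hall] with V' hV'
  by_cases h0 : margDensity (fieldMeasure (F.P K) k (SU N)) (fieldMeasure (F.P K) (k + 1) (SU N)) (avOfRecord F N K k).avg V' = 0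
  · rw [transportOfRecord_eq_zero_of_margDensity_eq_zero F N K k _ V' h0]
    exact (Finset.sum_eq_zero fun i _ => transportOfRecord_eq_zero_of_margDensity_eq_zero F N K k _ V' h0).symm
  · show kernelTransport _ _ _ (fun U => ∑ i ∈ S, f i V' U) V' = ∑ i ∈ S, kernelTransport _ _ _ (f i V') V'
    simp only [kernelTransport]
    rw [integral_finsetSum S (fun i hi => hV' i hi h0), Finset.mul_sum]

variable {F N}

/-- **★ THE A.E. FACE OF THE LEVEL-(k+1) NO-EXPANSION SLOT UNDER GRAPH-INTEGRABILITY ALONE** (p558069's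
`TkOfRecord_succ_ae_eq_sum_transportOfRecord_of_Omega_empty_of_integrable` with `hm` dropped): for `k < K`, `Ω_{k+1}(s′) = ∅`, new integrands per old branch whose
graph restrictions are `dU₀`-integrable, `𝐓_{k+1}(s′)Φ` IS the sum over the old index of def-T's transports of the new integrands, `dV′`-a.e.
[cite: Balaban1988Convergent, (2.21)–(2.22) p.258, (3.1) p.264, (3.24)–(3.25) p.270] -/
theorem TkOfRecord_succ_ae_eq_sum_transportOfRecord_of_Omega_empty_of_graph {V : Type} [NormedAddCommGroup V] [InnerProductSpace ℝ V]
    [FiniteDimensional ℝ V] [MeasurableSpace V] [BorelSpace V] (ν : Stage7Numerics) (M : ℕ) (g : ℕ → ℝ) (K : ℕ) (W : TkWeights F N V K)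
    {k : ℕ} (hk : k < K) (s : SeqOfRecord F ν M g K (k + 1)) (hΩ : s.Ω (k + 1) = ∅)
    (Φ : SFluct (F.P K) V → B15DeterminingSets.MSField (F.P K) (SU N) → ℝ)
    (hI : ∀ S ∈ admSOfRecord F ν M g K k s.init, Integrable (fun U₀ : GaugeField (F.P K) k (SU N) => noExpIntegrandAt F N V K k W
      (tkBranchOfRecord F N V ν M g K W s.init S k (fun ω => Φ (S, fun j => (ω j).2) (fun j => (ω j).1))) ((avOfRecord F N K k).avg U₀) U₀)
      (fieldMeasure (F.P K) k (SU N))) :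
    TkOfRecord F N V ν M g K W (k + 1) s Φ =ᵐ[fieldMeasure (F.P K) (k + 1) (SU N)]
      fun V' => ∑ S ∈ admSOfRecord F ν M g K k s.init, transportOfRecord F N K k (noExpIntegrandAt F N V K k W
        (tkBranchOfRecord F N V ν M g K W s.init S k (fun ω => Φ (S, fun j => (ω j).2) (fun j => (ω j).1))) V') V' := by
  classical
  set D := genDataOfRecord F N V ν M g K W s (fun _ => ∅) k with hD
  have hV : ∀ b, b ∈ D.sV := mem_sV_of_Omega_empty V ν M g K W s (fun _ => ∅) k hΩ
  have hV' : ∀ b, b ∈ D.sV' := mem_sV'_of_Omega_empty V ν M g K W s (fun _ => ∅) k hΩ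
  have hface : ∀ S ∈ admSOfRecord F ν M g K k s.init,
      (fun V' : GaugeField (F.P K) (k + 1) (SU N) => kernelRTOfRecord F N K k D.sV D.sV'
        (fun y => noExpIntegrandAt F N V K k W
          (tkBranchOfRecord F N V ν M g K W s.init S k (fun ω => Φ (S, fun j => (ω j).2) (fun j => (ω j).1))) V'
          (Function.updateFinset (fun _ => 1) D.sV y)) (fun b => V' b)) =ᵐ[fieldMeasure (F.P K) (k + 1) (SU N)]
      fun V' => transportOfRecord F N K k (noExpIntegrandAt F N V K k W
        (tkBranchOfRecord F N V ν M g K W s.init S k (fun ω => Φ (S, fun j => (ω j).2) (fun j => (ω j).1))) V') V' := by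
    intro S hS
    have hIf : Integrable (fun U₀ : GaugeField (F.P K) k (SU N) => noExpIntegrandAt F N V K k W
        (tkBranchOfRecord F N V ν M g K W s.init S k (fun ω => Φ (S, fun j => (ω j).2) (fun j => (ω j).1))) ((avOfRecord F N K k).avg U₀)
        (Function.updateFinset (fun _ => 1) D.sV (fun b : ↥D.sV => U₀ b))) (fieldMeasure (F.P K) k (SU N)) := by
      refine (hI S hS).congr (ae_of_all _ fun U₀ => ?_)
      simp only [updateFinset_one_restrict_of_forall_mem hV]
    have h := kernelRTOfRecord_full_ae_eq_transportOfRecord_of_graph F N K k hk (hdec := inferInstance) D.sV hV D.sV' hV'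
      (fun (V' : GaugeField (F.P K) (k + 1) (SU N)) (y : ↥D.sV → SU N) => noExpIntegrandAt F N V K k W
        (tkBranchOfRecord F N V ν M g K W s.init S k (fun ω => Φ (S, fun j => (ω j).2) (fun j => (ω j).1))) V'
        (Function.updateFinset (fun _ => 1) D.sV y)) hIf
    filter_upwards [h] with V' h1
    rw [h1]
    simp only [updateFinset_one_restrict_of_forall_mem hV]
  have hall := (Filter.eventually_all_finset (admSOfRecord F ν M g K k s.init)).2 hface
  filter_upwards [hall] with V' hV'S
  rw [TkOfRecord_succ_eq_sum_kernelRT_of_Omega_empty ν M g K W s hΩ Φ V']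
  exact Finset.sum_congr rfl fun S hS => hV'S S hS

end Summit.QuantumFields.YangMills.Theorems.BalabanUVNodesN11TkFullBondTransportGraph

end
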